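import Literature.AlgebraicGeometry.Frobenioids.PadicFrobenioidPreModel
import Literature.AlgebraicGeometry.Frobenioids.ModelFrobenioidModelType
import HarnessLib

/-!
# Frobenioids II, Theorem 1.2 (i), "`C` is of … model … type", in THE [FrdI] Def. 4.5 (i) declaration
# `PreFrobenioid.IsOfModelType F hF hsq` consumed by [FrdI] Thm. 5.2 (iv) — PROOF (bridge + instance)

Mochizuki, *The geometry of Frobenioids II: poly-Frobenioids*, Kyushu J. Math. **62** (2008) 401–460,
§1, Theorem 1.2 (i), second sentence (Kyushu p. 407 = kurims p. 9): "For arbitrary `Λ`, the Frobenioid `C`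
is of isotropic, model, Aut-ample, Aut^sub-ample, End-ample, and quasi-Frobenius-trivial type, but not of
group-like type", with the printed proof (Kyushu p. 408 ll. 6–7): "In light of the definition of `C` as a
model Frobenioid, it follows from [Mzk5, Theorem 5.2(ii)], that `C` is of isotropic and model type"
[cite: MochizukiFrdII2008, Thm 1.2 (i) p.9]; [FrdI] Def. 4.5 (i) (kurims p. 86): model type = pre-model type
AND birationally Frobenius-normalized type [cite: MochizukiFrdI2008, Def. 4.5(i) p.86].

PROOF-ONLY companion (abc-iut cell, layer L1, seat abc-iut-w5-d214; DISCHARGE-L1 §0 row W11 =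
`FrdII:Thm1.2(i)` second sentence, the "model" clause; statements `PadicFrobenioidThm12.lean`, seat
abc-iut-L1-t4). CENSUS: the tree carries TWO renderings of [FrdI] Def. 4.5 (i) "birationally
Frobenius-normalized" — seat abc-iut-L1-t3's `PreFrobenioidData.IsBiratFrobenioidNormalizedObj B A` over an
abstract birationalization datum `B` (`DivisorMonoidCategoryTheoreticityDefs.lean`), and seat abc-iut-L6-t8's
`PreFrobenioid.IsBiratFrobeniusNormalized F hF hsq A` / `PreFrobenioid.IsOfModelType F hF hsq` for THE
birationalization `C^birat` (`ModelFrobenioidComparison.lean`, the hypothesis of `Thm52iv`; docstring there: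
"TODO-bridge via seat L6-t6's `BiratData` instance"). The `p`-adic side was proved in the FIRST vocabulary at
`B := PreFrobenioid.biratData hF hsq` (`PadicFrd.Datum.thm12_modelType_of_isOfFSMType`, seat abc-iut-w4-d108,
`PadicFrobenioidPreModel.lean`; birationally-Frobenius-normalized half seat abc-iut-L1-d10,
`PadicFrobenioidStandardType.lean`); the object-level bridge between the two renderings and [FrdI] Thm. 5.2 (ii)
"of model type" for EVERY model Frobenioid landed meanwhile (`PreFrobenioid.isBiratFrobeniusNormalized_iff_biratData`,
`ModelFrobenioid.isOfModelType_of_hasBiratSquares`, seat abc-iut-w4-d103, `ModelFrobenioidModelType.lean`, p413510) and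
is consumed here BY NAME. PROVED here:
* `PreFrobenioid.isOfBiratFrobeniusNormalizedType_iff_biratData` / `isOfModelType_iff_biratData` — the type-level
  form of that bridge: `IsOfModelType F hF hsq ↔ IsOfPreModelType F ∧ IsOfBiratFrobeniusNormalizedType (biratData hF hsq)`
  (the conjunction in which seat abc-iut-L1-t5's `Thm51iv_modelType` and the `p`-adic files state model type);
* `PadicFrd.Datum.thm12_isOfModelType` (+ `_of_isOfFSMType`, `_of_isOfFSMType'`) — the `p`-adic Frobenioid of
  a datum with `Φ`, `B` monoids on `D` (automatic over a base of FSM-type) IS OF MODEL TYPE in the declaration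
  `PreFrobenioid.IsOfModelType` that [FrdI] Thm. 5.2 (iv) consumes;
* `PadicFrd.Datum.thm12_i_types_of_slot` — abc-iut-L1-t4's schema `Thm12_i_types d V` HOLDS at every
  vocabulary record `V` whose model-type slot is implied by that declaration (the shape of THE binding), the
  other six clauses being abc-iut-L1-d10's (`thm12_i_types_of_isOfModelType`).
No definitions; no statement of the paper is strengthened; nothing here bears on [IUTchIII] Cor. 3.12.
-/

namespace Literature.AlgebraicGeometry.Frobenioids

open CategoryTheory Opposite

universe w v v' u u'

namespace PreFrobenioid

variable {D : Type u} [Category.{v} D] {Φ : Dᵒᵖ ⥤ CommMonCat.{w}}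
  {C : Type u'} [Category.{v'} C] {F : C ⥤ ElemFrobenioid Φ}

/-- **[FrdI] Def. 4.5 (i), bridge (type form)**: "`C` is of birationally Frobenius-normalized type" — every
object birationally Frobenius-normalized for `C^birat → F_{Φ^gp}` iff seat abc-iut-L1-t3's
`IsOfBiratFrobeniusNormalizedType` holds AT THE birationalization datum `biratData hF hsq`.
[cite: MochizukiFrdI2008, Def. 4.5(i) p.86] -/
theorem isOfBiratFrobeniusNormalizedType_iff_biratData (hF : IsFrobenioid F) (hsq : HasBiratSquares F) :
    (∀ A : C, IsBiratFrobeniusNormalized F hF hsq A) ↔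
      PreFrobenioidData.IsOfBiratFrobeniusNormalizedType (biratData hF hsq) :=
  ⟨fun h => ⟨fun A => (isBiratFrobeniusNormalized_iff_biratData (hF := hF) (hsq := hsq) A).mp (h A)⟩,
    fun h A => (isBiratFrobeniusNormalized_iff_biratData (hF := hF) (hsq := hsq) A).mpr (h.obj A)⟩

/-- **[FrdI] Def. 4.5 (i), bridge**: "`C` is of model type" in the declaration consumed by Thm. 5.2 (iv)
(`IsOfModelType F hF hsq` = pre-model ∧ every object birationally Frobenius-normalized for
`C^birat → F_{Φ^gp}`) iff pre-model type ∧ `IsOfBiratFrobeniusNormalizedType (biratData hF hsq)` (the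
conjunction in which seats abc-iut-L1-d10 / abc-iut-w4-d108 proved it for the `p`-adic Frobenioid and
abc-iut-L1-t5's `Thm51iv_modelType` states it). [cite: MochizukiFrdI2008, Def. 4.5(i) p.86] -/
theorem isOfModelType_iff_biratData (hF : IsFrobenioid F) (hsq : HasBiratSquares F) :
    IsOfModelType F hF hsq ↔
      IsOfPreModelType F ∧ PreFrobenioidData.IsOfBiratFrobeniusNormalizedType (biratData hF hsq) :=
  and_congr_right fun _ => isOfBiratFrobeniusNormalizedType_iff_biratData hF hsq

end PreFrobenioid

namespace PadicFrd

namespace Datum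

variable {D : Type u} [Category.{v} D] {p : ℕ} [Fact p.Prime] (d : Datum D p)

/-- **[FrdII] Thm. 1.2 (i), "`C` is of … model … type"** (Kyushu p. 407; proof p. 408 ll. 6–7: "In light of
the definition of `C` as a model Frobenioid, it follows from [Mzk5, Theorem 5.2(ii)], that `C` is of
isotropic and model type") in THE [FrdI] Def. 4.5 (i) declaration `PreFrobenioid.IsOfModelType` consumed by
[FrdI] Thm. 5.2 (iv): for a datum with `Φ`, `B` monoids on `D` (print's standing requirement, [FrdII] Ex. 1.1
(ii); so that `C → F_Φ` is a Frobenioid and THE birationalization exists) and any square-completion witness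
`hsq` ([FrdI] Prop. 1.11 (vii), e.g. `d.hasBiratSquares _`), the `p`-adic Frobenioid is of model type —
pre-model half `thm12_isOfPreModelType'` (seat abc-iut-w4-d108, any base), birationally-Frobenius-normalized
half `thm12_isOfBiratFrobeniusNormalizedType` (seat abc-iut-L1-d10), assembled through the Def. 4.5 (i) bridge.
[cite: MochizukiFrdII2008, Thm 1.2 (i) p.9] -/
theorem thm12_isOfModelType (h : d.IsMonoidData)
    (hsq : PreFrobenioid.HasBiratSquares d.structureFunctor) :
    PreFrobenioid.IsOfModelType d.structureFunctor (d.isFrobenioid_of_isMonoidData h) hsq :=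
  (PreFrobenioid.isOfModelType_iff_biratData _ hsq).mpr
    ⟨d.thm12_isOfPreModelType', d.thm12_isOfBiratFrobeniusNormalizedType h hsq⟩

/-- The same, obtained from [FrdI] Thm. 5.2 (ii) "of model type" for model Frobenioids in general
(`ModelFrobenioid.isOfModelType_of_hasBiratSquares`, seat abc-iut-w4-d103): the `p`-adic Frobenioid IS the model
Frobenioid of `(Φ, B, Div_B)` with `Φ` monoprime (hence divisorial) and `B` group-like — print's own route
(Kyushu p. 408 l. 6–7). [cite: MochizukiFrdII2008, Thm 1.2 (i) p.9] -/
theorem thm12_isOfModelType' (hF : PreFrobenioid.IsFrobenioid d.structureFunctor)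
    (hsq : PreFrobenioid.HasBiratSquares d.structureFunctor) :
    PreFrobenioid.IsOfModelType d.structureFunctor hF hsq :=
  ModelFrobenioid.isOfModelType_of_hasBiratSquares hF hsq (fun A => (d.isMonoprime (op A)).isDivisorial)
    d.objectwise_isGroupLike_B

/-- **[FrdII] Thm. 1.2 (i), "model type"**, PREMISE-FREE over a base of FSM-type (where `Φ`, `B` are
automatically monoids on `D`, `isMonoidData_of_isOfFSMType`), up to the choice of the square-completion
witness `hsq`. [cite: MochizukiFrdII2008, Thm 1.2 (i) p.9] -/
theorem thm12_isOfModelType_of_isOfFSMType (hD : IsOfFSMType D)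
    (hsq : PreFrobenioid.HasBiratSquares d.structureFunctor) :
    PreFrobenioid.IsOfModelType d.structureFunctor (d.isFrobenioid_of_isOfFSMType hD) hsq :=
  d.thm12_isOfModelType (d.isMonoidData_of_isOfFSMType hD) hsq

/-- The same with the square-completion witness supplied (`d.hasBiratSquares`): over a base of FSM-type the
`p`-adic Frobenioid is of model type for THE birationalization `Birat _ hF (d.hasBiratSquares hF)`.
[cite: MochizukiFrdII2008, Thm 1.2 (i) p.9] -/
theorem thm12_isOfModelType_of_isOfFSMType' (hD : IsOfFSMType D) :
    PreFrobenioid.IsOfModelType d.structureFunctor (d.isFrobenioid_of_isOfFSMType hD)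
      (d.hasBiratSquares (d.isFrobenioid_of_isOfFSMType hD)) :=
  d.thm12_isOfModelType_of_isOfFSMType hD _

/-- **[FrdII] Thm. 1.2 (i), second sentence, at the typed schema**: abc-iut-L1-t4's `Thm12_i_types d V`
HOLDS for every vocabulary record `V` whose "model type" slot is IMPLIED by the Def. 4.5 (i) declaration at
THE birationalization (the shape of THE binding `V.IsOfModelType := PreFrobenioid.IsOfModelType _ hF hsq`),
for a datum with `Φ`, `B` monoids on `D`; the remaining six clauses (isotropic, `Aut`-ample, `Aut^sub`-ample, `End`-ample,
quasi-Frobenius-trivial, not group-like) are abc-iut-L1-d10's `thm12_i_types_of_isOfModelType`.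
[cite: MochizukiFrdII2008, Thm 1.2 (i) p.9] -/
theorem thm12_i_types_of_slot (V : Thm12Vocab d) (h : d.IsMonoidData)
    (hsq : PreFrobenioid.HasBiratSquares d.structureFunctor)
    (hV : PreFrobenioid.IsOfModelType d.structureFunctor (d.isFrobenioid_of_isMonoidData h) hsq →
      V.IsOfModelType) :
    Thm12_i_types d V :=
  d.thm12_i_types_of_isOfModelType V (hV (d.thm12_isOfModelType h hsq))

end Datum

end PadicFrd

end Literature.AlgebraicGeometry.Frobenioids
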